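import Mathlib
import Literature.Computability.AlgebraicComplexity.RealTauKnownCases
import Literature.Computability.AlgebraicComplexity.MignonRessayreBound
import Summits.ValiantsHypothesis.ValiantsHypothesis.Theorems.LacunarySymmetroidMatrixDescartesStubNegRoots

/-!
# `MatrixDescartes` (stmt-ValiantsHypothesis-18050) — the LOW-RANK SECTOR: a size-free Descartes ceiling
# through the ranks of the coefficients, and the crux's inequality on that format family

HONEST FRAMING.  Cell `pub-symmetroid`, seat `val-sym-mdr-p2`; helper file `--supports` the crux
`Theses.LacunarySymmetroid.MatrixDescartes`.  It proves the crux's inequality `Z^q ≤ 2^(K⌊log₂K⌋)` on ONE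
structural format family (low-rank coefficients, every size `m`), nothing more: it decides nothing about
the crux in its window `K^(1+o(1)) ≤ m ≤ 2^(polylog K)` with coefficients of unrestricted rank, nothing about
the cell's registers `DoorA26` / `DoorA34`, and nothing about `VP ≠ VNP`.

THE SECTOR.  Let `F = ∑ₗ X^{dₗ} Sₗ` be a `K`-term lacunary pencil of real `m × m` matrices (no symmetry
needed) and `l₀` any term (the "pivot", of arbitrary rank).  Then the number `Z₊` of distinct positive zeros
of `det F` satisfies

  `Z₊ + 1 ≤ ∏_{l ≠ l₀} (rank Sₗ + 1)`            (`lowRankCeiling`),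

uniformly in the size `m`; in particular `Z₊ + 1 ≤ (r+1)^(K−1)` when every non-pivot coefficient has rank
`≤ r` (`lowRankCeiling_uniform`; rank-one letters: `Z₊ < 2^(K−1)`).  Consequently (`lowRankSector_mdr`,
`lowRankSector_eventually`) the crux's `q`-th inequality holds, for ALL sizes `m` and all exponents, on every
`K`-term pencil whose non-pivot coefficients have rank `< 2^s`, as soon as `q·s ≤ ⌊log₂ K⌋` (e.g. `K ≥ 2^(q s)`):
a format family outside the cell's census table (it contains arbitrarily fat formats `m ≫ K`) on which the
inequality of `MatrixDescartes` is a theorem.  Like the sharp trivial ceiling `Z₊ + 1 ≤ C(m+K−1, m)`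
(`stub_descartesCeiling`, by count vectors) this is a MONOMIAL COUNT, but the count is governed by matrix
structure (rank) instead of size: the two ceilings are incomparable (`(r+1)^(K−1)` vs `C(m+K−1, m)`), and the
low-rank one is the first on this summit that does not grow with `m`.

PROOF.  Row-multilinearity of the determinant (`Matrix.detRowAlternating`, `MultilinearMap.map_sum`) expands
`det F = ∑_{f : Fin m → Fin K} X^{∑ᵢ d(f i)} · C(det N_f)`, where `N_f` is the REAL matrix whose `i`-th row is
the `i`-th row of `S_{f i}` (`LowRankSector.det_pencil_eq_sum_rowChoice`).  If some term `l` is chosen by more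
than `rank Sₗ` rows, those rows of `N_f` are rows of `Sₗ`, hence linearly dependent, so `det N_f = 0`
(`Matrix.det_eq_zero_of_not_linearIndependent_rows`, `Matrix.rank_eq_finrank_span_row`;
`LowRankSector.det_rowChoice_eq_zero`).  The exponent `∑ᵢ d(f i) = ∑ₗ nₗ dₗ` depends only on the count
vector `n` of `f`, and `n_{l₀} = m − ∑_{l ≠ l₀} nₗ` is determined by the other counts; so the support of
`det F` has at most `∏_{l ≠ l₀} (rank Sₗ + 1)` elements (`LowRankSector.card_support_det_pencil_le`), and a
nonzero real polynomial has fewer distinct positive zeros than monomials (tree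
`Literature.Computability.AlgebraicComplexity.card_roots_toFinset_filter_pos_lt_card_support`).  For all real
zeros add the positive zeros of the reflected pencil `Sₗ ↦ (−1)^{dₗ} Sₗ` (same ranks) and the origin (tree
`stub_negRoots`): `Z ≤ 2·(2^s)^(K−1) − 1 ≤ 2^(sK)`, so `Z^q ≤ 2^(K·qs) ≤ 2^(K⌊log₂K⌋)`.
Elementary; Mathlib + two tree lemmas; axioms `propext`, `Classical.choice`, `Quot.sound`.
-/

-- layout Summits/ValiantsHypothesis/ValiantsHypothesis forces the duplicated namespace component
set_option linter.dupNamespace false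

namespace Summit.ValiantsHypothesis.ValiantsHypothesis.Theorems.LacunarySymmetroidMatrixDescartes

open Polynomial Finset
open scoped BigOperators Polynomial

namespace LowRankSector

variable {K m : ℕ}

/-- The exponent `∑ᵢ d (f i)` of a row-to-term map `f` is `∑ₗ nₗ dₗ` for its count vector
`nₗ = #{i | f i = l}`. [folklore] -/
theorem sum_exp_eq_sum_count (d : Fin K → ℕ) (f : Fin m → Fin K) :
    ∑ i, d (f i) = ∑ l, (univ.filter fun i => f i = l).card * d l := by
  rw [← Finset.sum_fiberwise' univ f d]
  refine Finset.sum_congr rfl fun l _ => ?_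
  rw [Finset.sum_const, smul_eq_mul]

/-- The counts of a row-to-term map `f : Fin m → Fin K` add up to `m`. [folklore] -/
theorem sum_count_eq (f : Fin m → Fin K) : ∑ l, (univ.filter fun i => f i = l).card = m := by
  rw [← Finset.card_eq_sum_card_fiberwise (f := f) (s := univ) (t := univ) (fun _ _ => by simp)]
  exact Finset.card_fin m

/-- **Row-choice expansion** (row-multilinearity of `det`): the determinant of the lacunary pencil
`∑ₗ X^{dₗ} Sₗ` is `∑_{f : Fin m → Fin K} X^{∑ᵢ d (f i)} · C (det N_f)`, where `N_f` is the real matrix whose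
`i`-th row is the `i`-th row of `S_{f i}`. [folklore] -/
theorem det_pencil_eq_sum_rowChoice (d : Fin K → ℕ) (S : Fin K → Matrix (Fin m) (Fin m) ℝ) :
    Matrix.det (∑ l, ((X : ℝ[X]) ^ d l) • (S l).map C) =
      ∑ f : Fin m → Fin K, X ^ (∑ i, d (f i)) * C (Matrix.det (Matrix.of fun i j => S (f i) i j)) := by
  have hM : (∑ l, ((X : ℝ[X]) ^ d l) • (S l).map C) =
      fun i => ∑ l, ((X : ℝ[X]) ^ d l) • (fun j => C (S l i j)) := by
    ext i j
    simp [Matrix.sum_apply, Matrix.smul_apply]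
  rw [hM]
  have h1 : Matrix.det ((fun i => ∑ l, ((X : ℝ[X]) ^ d l) • (fun j => C (S l i j)))
        : Matrix (Fin m) (Fin m) ℝ[X])
      = (Matrix.detRowAlternating : ((Fin m → ℝ[X]) [⋀^Fin m]→ₗ[ℝ[X]] ℝ[X])).toMultilinearMap
          (fun i => ∑ l, ((X : ℝ[X]) ^ d l) • (fun j => C (S l i j))) := rfl
  rw [h1, MultilinearMap.map_sum
        ((Matrix.detRowAlternating : ((Fin m → ℝ[X]) [⋀^Fin m]→ₗ[ℝ[X]] ℝ[X])).toMultilinearMap)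
        (fun i l => ((X : ℝ[X]) ^ d l) • (fun j => C (S l i j)))]
  refine Finset.sum_congr rfl fun f _ => ?_
  rw [MultilinearMap.map_smul_univ, Finset.prod_pow_eq_pow_sum, smul_eq_mul]
  congr 1
  rw [RingHom.map_det]
  rfl

/-- **Rank kills over-used terms**: if the row-to-term map `f` chooses the term `l` in more than
`rank Sₗ` rows, the rows of `N_f` indexed by that fibre are rows of `Sₗ`, hence linearly dependent, and
`det N_f = 0`. [folklore] -/
theorem det_rowChoice_eq_zero (S : Fin K → Matrix (Fin m) (Fin m) ℝ) (f : Fin m → Fin K) (l : Fin K)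
    (h : (S l).rank < (univ.filter fun i => f i = l).card) :
    Matrix.det (Matrix.of fun i j => S (f i) i j) = 0 := by
  apply Matrix.det_eq_zero_of_not_linearIndependent_rows
  intro hli
  have hsub : LinearIndependent ℝ
      (fun i : {i // f i = l} => (Matrix.of fun i j => S (f i) i j : Matrix (Fin m) (Fin m) ℝ) i.1) :=
    hli.comp _ Subtype.val_injective
  have heq : (fun i : {i // f i = l} => (Matrix.of fun i j => S (f i) i j : Matrix (Fin m) (Fin m) ℝ) i.1)
      = fun i : {i // f i = l} => (S l).row i.1 := by
    funext i
    ext j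
    simp [Matrix.row, i.2]
  rw [heq] at hsub
  have hcard := finrank_span_eq_card hsub
  have hle : Module.finrank ℝ (Submodule.span ℝ (Set.range fun i : {i // f i = l} => (S l).row i.1))
      ≤ (S l).rank := by
    rw [Matrix.rank_eq_finrank_span_row]
    exact Submodule.finrank_mono (Submodule.span_mono (by rintro _ ⟨i, rfl⟩; exact ⟨i.1, rfl⟩))
  rw [hcard, Fintype.card_subtype] at hle
  omega

/-- **Support of the pencil determinant, low-rank form**: every exponent of `det (∑ₗ X^{dₗ} Sₗ)` is
`(m − ∑_{l ≠ l₀} nₗ)·d_{l₀} + ∑_{l ≠ l₀} nₗ dₗ` for some vector `n` with `nₗ ≤ rank Sₗ` off the pivot `l₀`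
(and `n_{l₀} = 0`). [folklore] -/
theorem support_det_pencil_subset (l₀ : Fin K) (d : Fin K → ℕ) (S : Fin K → Matrix (Fin m) (Fin m) ℝ) :
    (Matrix.det (∑ l, ((X : ℝ[X]) ^ d l) • (S l).map C)).support ⊆
      (Fintype.piFinset fun l => if l = l₀ then ({0} : Finset ℕ) else Finset.range ((S l).rank + 1)).image
        (fun n : Fin K → ℕ => (m - ∑ l ∈ univ.erase l₀, n l) * d l₀ + ∑ l ∈ univ.erase l₀, n l * d l) := by
  intro e he
  rw [mem_support_iff, det_pencil_eq_sum_rowChoice, finsetSum_coeff] at he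
  obtain ⟨f, -, hf⟩ := Finset.exists_ne_zero_of_sum_ne_zero he
  rw [mul_comm, coeff_C_mul_X_pow] at hf
  have hef : e = ∑ i, d (f i) := by
    by_contra hne
    exact hf (if_neg hne)
  rw [if_pos hef] at hf
  -- every term is chosen at most `rank` times
  have hcnt : ∀ l, (univ.filter fun i => f i = l).card ≤ (S l).rank := by
    intro l
    by_contra hlt
    exact hf (det_rowChoice_eq_zero S f l (not_le.1 hlt))
  refine Finset.mem_image.2 ⟨fun l => if l = l₀ then 0 else (univ.filter fun i => f i = l).card, ?_, ?_⟩
  · refine Fintype.mem_piFinset.2 fun l => ?_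
    by_cases hl : l = l₀
    · subst hl
      simp
    · rw [if_neg hl, if_neg hl, Finset.mem_range]
      exact Nat.lt_succ_of_le (hcnt l)
  · have hsum1 : ∑ l ∈ univ.erase l₀, (if l = l₀ then 0 else (univ.filter fun i => f i = l).card)
        = ∑ l ∈ univ.erase l₀, (univ.filter fun i => f i = l).card :=
      Finset.sum_congr rfl fun l hl => if_neg (Finset.ne_of_mem_erase hl)
    have hsum2 : ∑ l ∈ univ.erase l₀, (if l = l₀ then 0 else (univ.filter fun i => f i = l).card) * d l
        = ∑ l ∈ univ.erase l₀, (univ.filter fun i => f i = l).card * d l :=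
      Finset.sum_congr rfl fun l hl => by rw [if_neg (Finset.ne_of_mem_erase hl)]
    rw [hsum1, hsum2]
    have htot := Finset.add_sum_erase univ (fun l => (univ.filter fun i => f i = l).card) (mem_univ l₀)
    rw [sum_count_eq f] at htot
    have hsub : m - ∑ l ∈ univ.erase l₀, (univ.filter fun i => f i = l).card
        = (univ.filter fun i => f i = l₀).card := by
      omega
    rw [hsub, hef, sum_exp_eq_sum_count d f]
    exact Finset.add_sum_erase univ (fun l => (univ.filter fun i => f i = l).card * d l) (mem_univ l₀)

/-- **Low-rank monomial count**: `det (∑ₗ X^{dₗ} Sₗ)` has at most `∏_{l ≠ l₀} (rank Sₗ + 1)` monomials, for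
every choice of pivot `l₀`. [folklore] -/
theorem card_support_det_pencil_le (l₀ : Fin K) (d : Fin K → ℕ) (S : Fin K → Matrix (Fin m) (Fin m) ℝ) :
    (Matrix.det (∑ l, ((X : ℝ[X]) ^ d l) • (S l).map C)).support.card
      ≤ ∏ l ∈ univ.erase l₀, ((S l).rank + 1) := by
  calc (Matrix.det (∑ l, ((X : ℝ[X]) ^ d l) • (S l).map C)).support.card
      ≤ ((Fintype.piFinset fun l =>
            if l = l₀ then ({0} : Finset ℕ) else Finset.range ((S l).rank + 1)).image
          (fun n : Fin K → ℕ =>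
            (m - ∑ l ∈ univ.erase l₀, n l) * d l₀ + ∑ l ∈ univ.erase l₀, n l * d l)).card :=
        Finset.card_le_card (support_det_pencil_subset l₀ d S)
    _ ≤ (Fintype.piFinset fun l =>
            if l = l₀ then ({0} : Finset ℕ) else Finset.range ((S l).rank + 1)).card :=
        Finset.card_image_le
    _ = ∏ l, (if l = l₀ then ({0} : Finset ℕ) else Finset.range ((S l).rank + 1)).card :=
        Fintype.card_piFinset _
    _ = ∏ l ∈ univ.erase l₀, ((S l).rank + 1) := by
        rw [← Finset.mul_prod_erase univ _ (mem_univ l₀), if_pos rfl, Finset.card_singleton, one_mul]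
        refine Finset.prod_congr rfl fun l hl => ?_
        rw [if_neg (Finset.ne_of_mem_erase hl), Finset.card_range]

end LowRankSector

/-- **LOW-RANK CEILING (size-free).**  For every `K`-term lacunary pencil `∑ₗ X^{dₗ} Sₗ` of real `m × m`
matrices (symmetric or not) and every pivot term `l₀`, the number of distinct positive zeros of the
determinant plus one is at most `∏_{l ≠ l₀} (rank Sₗ + 1)` — independently of the size `m` and of the
exponents.  (The determinant `0` has no counted roots and the product is `≥ 1`.) [folklore] -/
theorem lowRankCeiling {K m : ℕ} (l₀ : Fin K) (d : Fin K → ℕ) (S : Fin K → Matrix (Fin m) (Fin m) ℝ) :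
    ((Matrix.det (∑ l, ((Polynomial.X : Polynomial ℝ) ^ d l) • (S l).map Polynomial.C)).roots.toFinset.filter
        (fun t => 0 < t)).card + 1 ≤ ∏ l ∈ Finset.univ.erase l₀, ((S l).rank + 1) := by
  by_cases hP : Matrix.det (∑ l, ((Polynomial.X : Polynomial ℝ) ^ d l) • (S l).map Polynomial.C) = 0
  · rw [hP, Polynomial.roots_zero, Multiset.toFinset_zero, Finset.filter_empty, Finset.card_empty,
      zero_add]
    exact Finset.prod_pos fun l _ => Nat.succ_pos _
  · have h1 :=
      Literature.Computability.AlgebraicComplexity.card_roots_toFinset_filter_pos_lt_card_support hP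
    have h2 := LowRankSector.card_support_det_pencil_le l₀ d S
    exact Nat.succ_le_of_lt (lt_of_lt_of_le h1 h2)

/-- **Low-rank ceiling, uniform form**: if every non-pivot coefficient has rank `≤ r`, then
`Z₊ + 1 ≤ (r+1)^(K−1)`; rank-one letters around one arbitrary term give `Z₊ < 2^(K−1)`, for every size
`m`. [folklore] -/
theorem lowRankCeiling_uniform {K m : ℕ} (l₀ : Fin K) (r : ℕ) (d : Fin K → ℕ)
    (S : Fin K → Matrix (Fin m) (Fin m) ℝ) (hr : ∀ l, l ≠ l₀ → (S l).rank ≤ r) :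
    ((Matrix.det (∑ l, ((Polynomial.X : Polynomial ℝ) ^ d l) • (S l).map Polynomial.C)).roots.toFinset.filter
        (fun t => 0 < t)).card + 1 ≤ (r + 1) ^ (K - 1) := by
  refine (lowRankCeiling l₀ d S).trans ?_
  have hcard : (Finset.univ.erase l₀).card = K - 1 := by
    rw [Finset.card_erase_of_mem (Finset.mem_univ _), Finset.card_univ, Fintype.card_fin]
  rw [← hcard]
  exact Finset.prod_le_pow_card _ _ _ fun l hl => Nat.add_le_add_right (hr l (Finset.ne_of_mem_erase hl)) 1

/-- **The crux's inequality on the low-rank sector.**  For all `q, s` and every `K` with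
`q·s ≤ ⌊log₂ K⌋`, EVERY size `m`, all exponents `d` and all real `m × m` matrices `Sₗ` whose ranks off one
pivot term `l₀` are `< 2^s`, the number `Z` of distinct real zeros of `det (∑ₗ X^{dₗ} Sₗ)` satisfies
`Z^q ≤ 2^(K⌊log₂K⌋)` — the inequality of `MatrixDescartes`, here without its size bound and without
symmetry.  Proof: positive zeros of the pencil and of its reflection `Sₗ ↦ (−1)^{dₗ} Sₗ` (same rank bounds,
tree `Literature.Computability.AlgebraicComplexity.rank_smul_le`)
are each `< (2^s)^(K−1)` by `lowRankCeiling_uniform`, plus the origin (`stub_negRoots`):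
`Z ≤ 2(2^s)^(K−1) − 1 ≤ 2^(sK)`, and `sKq ≤ K⌊log₂K⌋`. [folklore] -/
theorem lowRankSector_mdr (q s K m : ℕ) (hK : q * s ≤ Nat.log 2 K) (l₀ : Fin K) (d : Fin K → ℕ)
    (S : Fin K → Matrix (Fin m) (Fin m) ℝ) (hr : ∀ l, l ≠ l₀ → (S l).rank < 2 ^ s) :
    (Matrix.det (∑ l, ((Polynomial.X : Polynomial ℝ) ^ d l) • (S l).map Polynomial.C)).roots.toFinset.card ^ q
      ≤ 2 ^ (K * Nat.log 2 K) := by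
  have hr' : ∀ l, l ≠ l₀ → (((-1 : ℝ) ^ d l) • S l).rank < 2 ^ s :=
    fun l hl => lt_of_le_of_lt (Literature.Computability.AlgebraicComplexity.rank_smul_le _ _) (hr l hl)
  obtain ⟨K', rfl⟩ : ∃ K', K = K' + 1 := ⟨K - 1, by have := Fin.pos l₀; omega⟩
  have h2s : 2 ^ s - 1 + 1 = 2 ^ s := Nat.sub_add_cancel Nat.one_le_two_pow
  have hA := lowRankCeiling_uniform l₀ (2 ^ s - 1) d S (fun l hl => Nat.le_sub_one_of_lt (hr l hl))
  have hB := lowRankCeiling_uniform l₀ (2 ^ s - 1) d (fun l => ((-1 : ℝ) ^ d l) • S l)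
    (fun l hl => Nat.le_sub_one_of_lt (hr' l hl))
  rw [h2s, Nat.add_sub_cancel] at hA hB
  have hZ := stub_negRoots (K' + 1) m d S
  have hP2 : 2 * (2 ^ s) ^ K' ≤ 2 ^ s * (2 ^ s) ^ K' + 1 := by
    rcases Nat.eq_zero_or_pos s with hs | hs
    · subst hs
      simp
    · have h2 : 2 ≤ 2 ^ s := by
        calc 2 = 2 ^ 1 := by norm_num
          _ ≤ 2 ^ s := Nat.pow_le_pow_right (by norm_num) hs
      nlinarith
  have hpow : 2 ^ (s * (K' + 1)) = 2 ^ s * (2 ^ s) ^ K' := by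
    rw [pow_mul, pow_succ, mul_comm]
  have hZle : (Matrix.det (∑ l, ((Polynomial.X : Polynomial ℝ) ^ d l) •
      (S l).map Polynomial.C)).roots.toFinset.card ≤ 2 ^ (s * (K' + 1)) := by
    rw [hpow]
    omega
  calc (Matrix.det (∑ l, ((Polynomial.X : Polynomial ℝ) ^ d l) •
          (S l).map Polynomial.C)).roots.toFinset.card ^ q
        ≤ (2 ^ (s * (K' + 1))) ^ q := Nat.pow_le_pow_left hZle q
    _ = 2 ^ ((K' + 1) * (q * s)) := by rw [← pow_mul]; ring_nf
    _ ≤ 2 ^ ((K' + 1) * Nat.log 2 (K' + 1)) :=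
        Nat.pow_le_pow_right (by norm_num) (Nat.mul_le_mul_left _ hK)

/-- **The low-rank sector satisfies `MatrixDescartes` eventually in `K`, uniformly in the size**: for all
`q, s`, all `K ≥ 2^(q·s)`, ALL `m` (no quasi-polynomial size bound is needed), all exponents and all real
`m × m` coefficient matrices with ranks `< 2^s` off one pivot term, `Z^q ≤ 2^(K⌊log₂K⌋)`.  This is the
quantifier shape of the crux (`K₀ = 2^(q s)`, every `c`) restricted to one format family outside the
census table; it says nothing about coefficients of unrestricted rank. [folklore] -/
theorem lowRankSector_eventually (q s : ℕ) :
    ∀ K m : ℕ, 2 ^ (q * s) ≤ K → ∀ (l₀ : Fin K) (d : Fin K → ℕ) (S : Fin K → Matrix (Fin m) (Fin m) ℝ),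
      (∀ l, l ≠ l₀ → (S l).rank < 2 ^ s) →
      (Matrix.det (∑ l, ((Polynomial.X : Polynomial ℝ) ^ d l) • (S l).map Polynomial.C)
        ).roots.toFinset.card ^ q ≤ 2 ^ (K * Nat.log 2 K) :=
  fun K m hK l₀ d S hr =>
    lowRankSector_mdr q s K m (Nat.le_log_of_pow_le (by norm_num) hK) l₀ d S hr

end Summit.ValiantsHypothesis.ValiantsHypothesis.Theorems.LacunarySymmetroidMatrixDescartes
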